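import Summits.HubbardSuperconductivity.HubbardSuperconductivity.Theorems.NodalWardXYPerturbedXYOrderChargedShift

/-!
# Crux `PerturbedXYOrder` (stmt-HubbardSuperconductivity-10739): the O(2)-invariance of the tilt is load-bearing —
# the CHARGED (magnetic-field) variant is FALSE (lead c18, line `schwarz-inheritance`; registered stub `stub_chargedFieldPinching`)

The crux `Theses.NodalWardXY.PerturbedXYOrder` asks for uniform-in-`L` zero-freeness (and order) of the low-temperature
rotator on `(ℤ/Lℤ)³` tilted by `e^{W_K}`, `W_K = Σ K(b,b') j_b j_{b'}` an O(2)-INVARIANT complex two-current perturbation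
with `‖W_K‖ ≤ C ε L³`.  The crux strategist's census (`Cruxes/PerturbedXYOrder/STRATEGY-CENSUS.md` §Negation N7, typed as
`PerturbedXYOrderChargedField` in `Cruxes/PerturbedXYOrder/StrategyCensusS1.lean`) records the PAPER verdict that the same
zero-freeness claim for the simplest NON-invariant tilt of that size — a complex magnetic field `η Σ_x cos θ_x`, `‖η‖ ≤ ε` —
is false.  This file proves it (`perturbedXYOrder_false_for_charged_field`, alias of the registered stub
`stub_chargedFieldPinching`), over the vocabulary of `Theorems/NodalWardXYDefs.lean`:

  `¬ ∃ J₀ ε > 0, ∀ J ≥ J₀, ∀ L ≥ 2, ∀ η ∈ ℂ, ‖η‖ ≤ ε → ∫_cube w_J e^{η Σ_x cos θ_x} dθ ≠ 0`.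

So, next to `perturbedXYOrder_false_without_lowT` (p73198: `J ≥ J₀` is load-bearing) and
`perturbedXYOrder_false_with_exponent_three` (p122024: the decay exponent `4` is load-bearing), this is the third typed edge
of the crux: the O(2)-INVARIANCE of `W_K` is load-bearing — no method that sees only "`‖W‖ ≤ C ε L³`, entire in the coupling,
`J ≥ J₀`" can prove `PerturbedXYOrder` (that triple is shared by `η Σ cos θ_x`).  Mechanism: Lee–Yang pinching in the ordered
phase.

Proof (all inputs in the tree).
* `cfp_log_norm_le_of_zeroFree` (tools file `Theorems/NodalWardXYPerturbedXYOrderChargedShift.lean`, landed for the registered stub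
  `stub_chargedShiftInvariance`) — complex analysis: if `G` is holomorphic and zero-free on `‖z‖ < R` with `G(0) = 1`,
  `G'(0) = 0`, `‖G‖ ≤ e^M`, then `log ‖G(z)‖ ≤ 8M‖z‖²/R²` for `‖z‖ < R/2` (holomorphic logarithm
  `Literature.Analysis.Complex.exists_log_on_ball`; Mathlib's Borel–Carathéodory `Complex.borelCaratheodory_zero`; Mathlib's
  Schwarz lemma of order two `Complex.dist_le_mul_div_pow_of_mapsTo_ball_of_isLittleO`).
* `cfp_setIntegral_shift` / `stub_chargedShiftInvariance` (tools file) — global rotation invariance `θ ↦ θ + u` of `w_J dθ` on the cube, via the tree's transfer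
  `setIntegral_angleCube_comp_exp` to the torus `U(1)^Λ` and invariance of its Haar measure (`integral_torusHaar_mul_right`);
  hence the charged partition function `Z(η) = ∫ w_J e^{η Σ cos θ_x}` is even (`u = π`) and equals `∫ w_J e^{± η Σ sin θ_x}`
  (`u = ∓ π/2`).
* §A below, `cfp_lower_bound` — long-range order pinches from below: the landed real plateau `realPlateau` (p86048) gives
  `∫ (Φ² + Ψ²) w_J ≥ a₀ L⁶ ∫ w_J` (`Φ = Σ cos θ_x`, `Ψ = Σ sin θ_x`, `Σ_{x,y} cos(θ_x − θ_y) = Φ² + Ψ²`), and pointwise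
  `e^{tΦ} + e^{−tΦ} + e^{tΨ} + e^{−tΨ} ≥ e^{t √a₀ L³/2} ((Φ² + Ψ²)/L⁶ − a₀/2)`; integrating,
  `4 Z(t) ≥ (a₀/2) e^{t √a₀ L³/2} Z(0)` for real `t ≥ 0`.
* (tools file) growth `‖Z(η)‖ ≤ e^{‖η‖ L³} Z(0)`, evenness, and the four-term identity `4 Z(t) = ∫ w_J (e^{tΦ} + e^{−tΦ} + e^{tΨ} + e^{−tΨ})`.
* §B below: with `J = max J₀ J₁`, `G = Z/Z(0)` on `‖η‖ < ε`, `M = ε L³`, `t = √a₀ ε/32`: `log(a₀/8) + t √a₀ L³/2 ≤ 8 L³ t²/ε`, i.e.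
  `L³ ≤ 128 log(8/a₀)/(a₀ ε)` — false for `L = max 2 (⌈128 log(8/a₀)/(a₀ ε)⌉₊ + 1)`.
-/

noncomputable section

namespace Summit.HubbardSuperconductivity.HubbardSuperconductivity.Theorems.PerturbedXYOrder

open MeasureTheory Literature.Probability.LatticeModels Metric Set
open Summit.HubbardSuperconductivity.HubbardSuperconductivity.Theses.NodalWardXY

variable {L : ℕ}

/-! ### A. The real lower bound: long-range order pinches the charged partition function from below -/

/-- Pointwise pinching: if `P² + Q² ≤ N²` then
`e^{t (√a/2) N} ((P² + Q²)/N² − a/2) ≤ e^{tP} + e^{−tP} + e^{tQ} + e^{−tQ}` for `t, a ≥ 0`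
(on `P² + Q² > aN²/2` one of `|P|, |Q|` exceeds `√a N/2`). -/
theorem cfp_pointwise {P Q t a N : ℝ} (ht : 0 ≤ t) (ha : 0 ≤ a) (hN : 0 < N) (hS : P ^ 2 + Q ^ 2 ≤ N ^ 2) :
    Real.exp (t * (Real.sqrt a / 2 * N)) * ((P ^ 2 + Q ^ 2) / N ^ 2 - a / 2) ≤
      Real.exp (t * P) + Real.exp (-(t * P)) + Real.exp (t * Q) + Real.exp (-(t * Q)) := by
  have h4pos : 0 < Real.exp (t * P) + Real.exp (-(t * P)) + Real.exp (t * Q) + Real.exp (-(t * Q)) := by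
    positivity
  by_cases h : (P ^ 2 + Q ^ 2) / N ^ 2 - a / 2 ≤ 0
  · have : Real.exp (t * (Real.sqrt a / 2 * N)) * ((P ^ 2 + Q ^ 2) / N ^ 2 - a / 2) ≤ 0 :=
      mul_nonpos_iff.2 (Or.inl ⟨(Real.exp_pos _).le, h⟩)
    linarith
  push Not at h
  have hN2 : 0 < N ^ 2 := by positivity
  have hS2 : a * N ^ 2 / 2 < P ^ 2 + Q ^ 2 := by
    have h' : a / 2 < (P ^ 2 + Q ^ 2) / N ^ 2 := by linarith
    rw [lt_div_iff₀ hN2] at h'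
    linarith
  have hfac : (P ^ 2 + Q ^ 2) / N ^ 2 - a / 2 ≤ 1 := by
    have : (P ^ 2 + Q ^ 2) / N ^ 2 ≤ 1 := (div_le_one hN2).2 hS
    linarith
  have hlsq : (Real.sqrt a / 2 * N) ^ 2 = a * N ^ 2 / 4 := by
    rw [mul_pow, div_pow, Real.sq_sqrt ha]; ring
  have hPQ : Real.sqrt a / 2 * N < |P| ∨ Real.sqrt a / 2 * N < |Q| := by
    by_contra hcon
    push Not at hcon
    obtain ⟨hP, hQ⟩ := hcon
    have hP2 : P ^ 2 ≤ a * N ^ 2 / 4 := by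
      rw [← hlsq, ← sq_abs P]; exact pow_le_pow_left₀ (abs_nonneg P) hP 2
    have hQ2 : Q ^ 2 ≤ a * N ^ 2 / 4 := by
      rw [← hlsq, ← sq_abs Q]; exact pow_le_pow_left₀ (abs_nonneg Q) hQ 2
    linarith
  have habsP : Real.exp (t * |P|) ≤ Real.exp (t * P) + Real.exp (-(t * P)) := by
    rcases abs_choice P with h' | h' <;> rw [h']
    · linarith [Real.exp_pos (-(t * P))]
    · rw [mul_neg]; linarith [Real.exp_pos (t * P)]
  have habsQ : Real.exp (t * |Q|) ≤ Real.exp (t * Q) + Real.exp (-(t * Q)) := by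
    rcases abs_choice Q with h' | h' <;> rw [h']
    · linarith [Real.exp_pos (-(t * Q))]
    · rw [mul_neg]; linarith [Real.exp_pos (t * Q)]
  have key : Real.exp (t * (Real.sqrt a / 2 * N)) ≤ Real.exp (t * |P|) + Real.exp (t * |Q|) := by
    rcases hPQ with hP | hQ
    · have : Real.exp (t * (Real.sqrt a / 2 * N)) ≤ Real.exp (t * |P|) :=
        Real.exp_le_exp.2 (mul_le_mul_of_nonneg_left hP.le ht)
      linarith [Real.exp_pos (t * |Q|)]
    · have : Real.exp (t * (Real.sqrt a / 2 * N)) ≤ Real.exp (t * |Q|) :=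
        Real.exp_le_exp.2 (mul_le_mul_of_nonneg_left hQ.le ht)
      linarith [Real.exp_pos (t * |P|)]
  calc Real.exp (t * (Real.sqrt a / 2 * N)) * ((P ^ 2 + Q ^ 2) / N ^ 2 - a / 2)
      ≤ Real.exp (t * (Real.sqrt a / 2 * N)) * 1 :=
        mul_le_mul_of_nonneg_left hfac (Real.exp_pos _).le
    _ ≤ Real.exp (t * |P|) + Real.exp (t * |Q|) := by rw [mul_one]; exact key
    _ ≤ _ := by linarith

/-- `Σ_{x,y} cos(θ_x − θ_y) = (Σ_x cos θ_x)² + (Σ_x sin θ_x)²`. -/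
theorem cfp_sum_cos_sub [NeZero L] (θ : TorusSite 3 L → ℝ) :
    ∑ x : TorusSite 3 L, ∑ y : TorusSite 3 L, Real.cos (θ x - θ y) =
      (∑ x : TorusSite 3 L, Real.cos (θ x)) ^ 2 + (∑ x : TorusSite 3 L, Real.sin (θ x)) ^ 2 := by
  simp_rw [Real.cos_sub]
  rw [sq, sq, Finset.sum_mul_sum, Finset.sum_mul_sum, ← Finset.sum_add_distrib]
  refine Finset.sum_congr rfl fun x _ => ?_
  rw [← Finset.sum_add_distrib]

/-- `(Σ_x cos θ_x)² + (Σ_x sin θ_x)² ≤ N²`, `N = L³ = |Λ|`. -/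
theorem cfp_sq_add_sq_le [NeZero L] (θ : TorusSite 3 L → ℝ) :
    (∑ x : TorusSite 3 L, Real.cos (θ x)) ^ 2 + (∑ x : TorusSite 3 L, Real.sin (θ x)) ^ 2 ≤
      ((L : ℝ) ^ 3) ^ 2 := by
  rw [← cfp_sum_cos_sub]
  calc ∑ x : TorusSite 3 L, ∑ y : TorusSite 3 L, Real.cos (θ x - θ y)
      ≤ ∑ _x : TorusSite 3 L, ∑ _y : TorusSite 3 L, (1 : ℝ) := by
        gcongr with x _ y _
        exact Real.cos_le_one _
    _ = ((L : ℝ) ^ 3) ^ 2 := by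
        simp only [Finset.sum_const, Finset.card_univ, nsmul_eq_mul, Fintype.card_fun, Fintype.card_fin,
          ZMod.card, mul_one]
        push_cast; ring

/-- **Long-range order pinches from below.** If the `K = 0` plateau at `(J, L)` is at least `a₀ ≥ 0`, then for
every `t ≥ 0`
`(a₀/2) e^{t (√a₀/2) L³} ∫ w_J ≤ ∫ w_J (e^{tΦ} + e^{−tΦ} + e^{tΨ} + e^{−tΨ})`, `Φ = Σ cos θ_x`, `Ψ = Σ sin θ_x`
(Chebyshev on `|m_L|² = (Φ² + Ψ²)/L⁶`, whose mean is the plateau, and `cfp_pointwise`). -/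
theorem cfp_lower_bound [NeZero L] {J a₀ : ℝ} (ha₀ : 0 ≤ a₀)
    (hplat : a₀ ≤ (cratio L J (0 : Bond L → Bond L → ℂ)).re) {t : ℝ} (ht : 0 ≤ t) :
    a₀ / 2 * Real.exp (t * (Real.sqrt a₀ / 2 * (L : ℝ) ^ 3)) *
        ∫ θ in cube L, Real.exp (J * ∑ b : Bond L, Real.cos (θ (b.1 + Pi.single b.2 1) - θ b.1)) ≤
      ∫ θ in cube L, Real.exp (J * ∑ b : Bond L, Real.cos (θ (b.1 + Pi.single b.2 1) - θ b.1)) *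
        (Real.exp (t * ∑ x, Real.cos (θ x)) + Real.exp (-(t * ∑ x, Real.cos (θ x))) +
          Real.exp (t * ∑ x, Real.sin (θ x)) + Real.exp (-(t * ∑ x, Real.sin (θ x)))) := by
  set w : (TorusSite 3 L → ℝ) → ℝ := fun θ =>
    Real.exp (J * ∑ b : Bond L, Real.cos (θ (b.1 + Pi.single b.2 1) - θ b.1)) with hw
  set P : (TorusSite 3 L → ℝ) → ℝ := fun θ => ∑ x, Real.cos (θ x) with hP
  set Q : (TorusSite 3 L → ℝ) → ℝ := fun θ => ∑ x, Real.sin (θ x) with hQ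
  set N : ℝ := (L : ℝ) ^ 3 with hN
  set E : ℝ := Real.exp (t * (Real.sqrt a₀ / 2 * N)) with hE
  have hL0 : (0 : ℝ) < L := by exact_mod_cast NeZero.pos L
  have hNpos : 0 < N := by positivity
  have hwc : Continuous w := continuous_xyWeight J
  have hPc : Continuous P := by fun_prop
  have hQc : Continuous Q := by fun_prop
  have hZ : 0 < ∫ θ in cube L, w θ := integral_xyWeight_pos J
  have hint : ∀ {f : (TorusSite 3 L → ℝ) → ℝ}, Continuous f → Integrable f (volume.restrict (cube L)) :=
    fun hf => hf.continuousOn.integrableOn_compact ent_isCompact_cube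
  -- the plateau in integral form: `a₀ (∫ w) L⁶ ≤ ∫ (P² + Q²) w`
  have hre : (cratio L J (0 : Bond L → Bond L → ℂ)).re =
      (∑ x : TorusSite 3 L, ∑ y : TorusSite 3 L, ∫ θ in cube L, Real.cos (θ x - θ y) * w θ) /
        ((∫ θ in cube L, w θ) * (L : ℝ) ^ 6) := by
    rw [even_re_cratio_zero]; rfl
  have hsum_int : ∑ x : TorusSite 3 L, ∑ y : TorusSite 3 L, ∫ θ in cube L, Real.cos (θ x - θ y) * w θ =
      ∫ θ in cube L, (P θ ^ 2 + Q θ ^ 2) * w θ := by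
    have hxy : ∀ x y : TorusSite 3 L,
        Integrable (fun θ : TorusSite 3 L → ℝ => Real.cos (θ x - θ y) * w θ) (volume.restrict (cube L)) :=
      fun x y => hint ((by fun_prop : Continuous fun θ : TorusSite 3 L → ℝ => Real.cos (θ x - θ y)).mul hwc)
    have h1 : ∀ x : TorusSite 3 L, ∑ y : TorusSite 3 L, ∫ θ in cube L, Real.cos (θ x - θ y) * w θ =
        ∫ θ in cube L, ∑ y : TorusSite 3 L, Real.cos (θ x - θ y) * w θ :=
      fun x => (integral_finsetSum _ fun y _ => hxy x y).symm
    simp_rw [h1]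
    rw [← integral_finsetSum _ fun x _ => integrable_finsetSum _ fun y _ => hxy x y]
    refine integral_congr_ae (ae_of_all _ fun θ => ?_)
    show ∑ x : TorusSite 3 L, ∑ y : TorusSite 3 L, Real.cos (θ x - θ y) * w θ = (P θ ^ 2 + Q θ ^ 2) * w θ
    rw [hP, hQ]
    simp only
    rw [← cfp_sum_cos_sub, Finset.sum_mul]
    refine Finset.sum_congr rfl fun x _ => ?_
    rw [Finset.sum_mul]
  have hmom : a₀ * ((∫ θ in cube L, w θ) * (L : ℝ) ^ 6) ≤ ∫ θ in cube L, (P θ ^ 2 + Q θ ^ 2) * w θ := by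
    rw [← hsum_int, ← le_div_iff₀ (by positivity), ← hre]
    exact hplat
  -- pointwise pinching, integrated
  have hpt : ∀ θ : TorusSite 3 L → ℝ,
      E / N ^ 2 * ((P θ ^ 2 + Q θ ^ 2) * w θ) - E * (a₀ / 2) * w θ ≤
        w θ * (Real.exp (t * P θ) + Real.exp (-(t * P θ)) + Real.exp (t * Q θ) + Real.exp (-(t * Q θ))) := by
    intro θ
    have h := cfp_pointwise (P := P θ) (Q := Q θ) ht ha₀ hNpos (by rw [hN]; exact cfp_sq_add_sq_le θ)
    have hwθ : 0 ≤ w θ := (Real.exp_pos _).le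
    have h2 := mul_le_mul_of_nonneg_left h hwθ
    calc E / N ^ 2 * ((P θ ^ 2 + Q θ ^ 2) * w θ) - E * (a₀ / 2) * w θ
        = w θ * (E * ((P θ ^ 2 + Q θ ^ 2) / N ^ 2 - a₀ / 2)) := by
          field_simp
      _ ≤ _ := h2
  have hIA : Integrable (fun θ => E / N ^ 2 * ((P θ ^ 2 + Q θ ^ 2) * w θ)) (volume.restrict (cube L)) := by
    refine (hint ?_).const_mul _
    fun_prop
  have hIB : Integrable (fun θ => E * (a₀ / 2) * w θ) (volume.restrict (cube L)) := (hint hwc).const_mul _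
  have hI2 : Integrable (fun θ => w θ * (Real.exp (t * P θ) + Real.exp (-(t * P θ)) +
      Real.exp (t * Q θ) + Real.exp (-(t * Q θ)))) (volume.restrict (cube L)) := by
    refine hint (hwc.mul ?_)
    fun_prop
  have hmono : ∫ θ in cube L, (E / N ^ 2 * ((P θ ^ 2 + Q θ ^ 2) * w θ) - E * (a₀ / 2) * w θ) ≤
      ∫ θ in cube L, w θ * (Real.exp (t * P θ) + Real.exp (-(t * P θ)) +
        Real.exp (t * Q θ) + Real.exp (-(t * Q θ))) := integral_mono (hIA.sub hIB) hI2 hpt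
  have hsplit : ∫ θ in cube L, (E / N ^ 2 * ((P θ ^ 2 + Q θ ^ 2) * w θ) - E * (a₀ / 2) * w θ) =
      E / N ^ 2 * (∫ θ in cube L, (P θ ^ 2 + Q θ ^ 2) * w θ) - E * (a₀ / 2) * ∫ θ in cube L, w θ := by
    rw [integral_sub hIA hIB, integral_const_mul, integral_const_mul]
  rw [hsplit] at hmono
  have hEpos : 0 < E := Real.exp_pos _
  have hL6 : (L : ℝ) ^ 6 = N ^ 2 := by rw [hN]; ring
  rw [hL6] at hmom
  have hstep : a₀ / 2 * E * ∫ θ in cube L, w θ ≤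
      E / N ^ 2 * (∫ θ in cube L, (P θ ^ 2 + Q θ ^ 2) * w θ) - E * (a₀ / 2) * ∫ θ in cube L, w θ := by
    have h3 : E / N ^ 2 * (a₀ * ((∫ θ in cube L, w θ) * N ^ 2)) ≤
        E / N ^ 2 * ∫ θ in cube L, (P θ ^ 2 + Q θ ^ 2) * w θ :=
      mul_le_mul_of_nonneg_left hmom (by positivity)
    have h4 : E / N ^ 2 * (a₀ * ((∫ θ in cube L, w θ) * N ^ 2)) = E * a₀ * ∫ θ in cube L, w θ := by
      field_simp
    rw [h4] at h3
    nlinarith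
  exact hstep.trans hmono

/-! ### B. The theorem -/

/-- **The charged-field variant of the crux is FALSE** (registered stub `stub_chargedFieldPinching` of the line
`schwarz-inheritance`; census `Cruxes/PerturbedXYOrder/STRATEGY-CENSUS.md` §Negation N7, typed there as
`PerturbedXYOrderChargedField` — this is literally its negation with `Zfield` unfolded).  "Uniform-in-`L` zero-freeness of
the low-temperature rotator under a complex MAGNETIC FIELD of size `≤ ε`" fails: for `J ≥ max J₀ J₁` (`J₁`, `a₀` from the
landed real plateau `realPlateau`), `G(η) = Z^field_η / Z^field_0` is entire, even (`θ ↦ θ + π`), of growth `≤ e^{‖η‖ L³}`,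
and for real `t > 0` pinched from below by long-range order, `G(t) ≥ (a₀/8) e^{t (√a₀/2) L³}` (`θ ↦ θ ± π/2` turns `Σ cos`
into `± Σ sin`, and `‖m_L‖² ≥ a₀/2` with probability `≥ a₀/2`); if `G` had no zero in `‖η‖ ≤ ε` then
`log ‖G(η)‖ ≤ 8 L³ ‖η‖²/ε` on `‖η‖ < ε/2` (`cfp_log_norm_le_of_zeroFree`), which at `t = √a₀ ε/32` forces
`L³ ≤ 128 log(8/a₀)/(a₀ ε)` — false for large `L`.  Hence O(2)-INVARIANCE of the two-current tilt `W_K` is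
load-bearing in `PerturbedXYOrder`: no method seeing only `‖W‖ ≤ C ε L³`, analyticity in the coupling and `J ≥ J₀`
can prove the crux (Lee–Yang pinching in the ordered phase). -/
theorem stub_chargedFieldPinching :
    ¬ (∃ J₀ ε : ℝ, 0 < ε ∧ ∀ J : ℝ, J₀ ≤ J → ∀ (L : ℕ) [NeZero L], 2 ≤ L →
        ∀ η : ℂ, ‖η‖ ≤ ε →
          (∫ θ in cube L, wJ J θ * Complex.exp (η * ∑ x : TorusSite 3 L, (Real.cos (θ x) : ℂ))) ≠ 0) := by
  rintro ⟨J₀, ε, hε, h⟩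
  obtain ⟨J₁, a₀, ha₀, hplat⟩ := realPlateau
  set J : ℝ := max J₀ J₁ with hJ
  -- the volume
  set B : ℝ := 128 * Real.log (8 / a₀) / (a₀ * ε) with hB
  set L : ℕ := max 2 (⌈B⌉₊ + 1) with hLdef
  have hL2 : 2 ≤ L := le_max_left _ _
  haveI : NeZero L := ⟨by omega⟩
  have hL1 : (1 : ℝ) ≤ L := by exact_mod_cast (show 1 ≤ L by omega)
  have hBL : B < L := by
    have h1 : (⌈B⌉₊ + 1 : ℕ) ≤ L := le_max_right _ _
    have h2 : ((⌈B⌉₊ + 1 : ℕ) : ℝ) ≤ (L : ℝ) := by exact_mod_cast h1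
    push_cast at h2
    linarith [Nat.le_ceil B]
  set N : ℝ := (L : ℝ) ^ 3 with hN
  have hNpos : 0 < N := by positivity
  have hLN : (L : ℝ) ≤ N := by
    rw [hN]
    nlinarith [mul_nonneg (sub_nonneg.2 hL1) (by positivity : (0 : ℝ) ≤ (L : ℝ) * ((L : ℝ) + 1))]
  have hBN : B < N := hBL.trans_le hLN
  -- the plateau at `(J, L)`
  obtain ⟨hpl, hn1⟩ := hplat J (le_max_right _ _) L hL2
  have ha1 : a₀ ≤ 1 := hpl.trans ((Complex.re_le_norm _).trans hn1)
  -- the charged partition function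
  set Zf : ℂ → ℂ := fun η =>
    ∫ θ in cube L, wJ J θ * Complex.exp (η * ∑ x : TorusSite 3 L, (Real.cos (θ x) : ℂ)) with hZf
  set w : (TorusSite 3 L → ℝ) → ℝ := fun θ =>
    Real.exp (J * ∑ b : Bond L, Real.cos (θ (b.1 + Pi.single b.2 1) - θ b.1)) with hw
  have hZ0pos : 0 < ∫ θ in cube L, w θ := integral_xyWeight_pos J
  have hZf0 : Zf 0 = ((∫ θ in cube L, w θ : ℝ) : ℂ) := by
    simp only [hZf, zero_mul, Complex.exp_zero, mul_one]
    unfold wJ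
    rw [integral_complex_ofReal]
  have hZf0_ne : Zf 0 ≠ 0 := by
    rw [hZf0, Ne, Complex.ofReal_eq_zero]; exact hZ0pos.ne'
  have hnormZf0 : ‖Zf 0‖ = ∫ θ in cube L, w θ := by
    rw [hZf0, Complex.norm_real, Real.norm_eq_abs, abs_of_pos hZ0pos]
  have hZf_ne : ∀ η : ℂ, ‖η‖ ≤ ε → Zf η ≠ 0 := fun η hη => h J (le_max_left _ _) L hL2 η hη
  have hZf_diff : Differentiable ℂ Zf := by
    haveI := ent_isFiniteMeasure_restrict_cube (L := L)
    have hW : Continuous fun θ : TorusSite 3 L → ℝ => ∑ x : TorusSite 3 L, (Real.cos (θ x) : ℂ) := by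
      fun_prop
    exact ent_differentiable_integral_mul_cexp (μ := volume.restrict (cube L))
      (ent_continuous_wJ J).aestronglyMeasurable hW.aestronglyMeasurable (ent_norm_wJ_le J)
      (fun θ => cfp_norm_sum_cos_le θ)
  have hZf_even : ∀ η : ℂ, Zf (-η) = Zf η := fun η => cfp_Zfield_neg J η
  have hZf_norm : ∀ η : ℂ, ‖Zf η‖ ≤ Real.exp (‖η‖ * N) * ∫ θ in cube L, w θ :=
    fun η => cfp_norm_Zfield_le J η
  -- the normalised function `G`
  set G : ℂ → ℂ := fun η => Zf η / Zf 0 with hG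
  have hGd : DifferentiableOn ℂ G (ball 0 ε) := (hZf_diff.div_const (Zf 0)).differentiableOn
  have hG0 : ∀ z ∈ ball (0 : ℂ) ε, G z ≠ 0 := fun z hz =>
    div_ne_zero (hZf_ne z (le_of_lt (mem_ball_zero_iff.1 hz))) hZf0_ne
  have hG1 : G 0 = 1 := div_self hZf0_ne
  have hGbd : ∀ z ∈ ball (0 : ℂ) ε, ‖G z‖ ≤ Real.exp (N * ε) := by
    intro z hz
    rw [mem_ball_zero_iff] at hz
    rw [hG]
    simp only
    rw [norm_div, hnormZf0, div_le_iff₀ hZ0pos]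
    refine (hZf_norm z).trans (mul_le_mul_of_nonneg_right (Real.exp_le_exp.2 ?_) hZ0pos.le)
    nlinarith [norm_nonneg z]
  have hGeven : ∀ z, G (-z) = G z := fun z => by simp only [hG, hZf_even]
  have hGder : deriv G 0 = 0 := cfp_deriv_zero_of_even hGeven
  -- the pinch point `t = √a₀ ε / 32`
  set l : ℝ := Real.sqrt a₀ / 2 with hl
  have hlpos : 0 < l := by rw [hl]; exact div_pos (Real.sqrt_pos.2 ha₀) two_pos
  have hl1 : l ≤ 1 / 2 := by
    rw [hl]
    have : Real.sqrt a₀ ≤ 1 := (Real.sqrt_le_sqrt ha1).trans_eq Real.sqrt_one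
    linarith
  have hl2 : l ^ 2 = a₀ / 4 := by rw [hl, div_pow, Real.sq_sqrt ha₀.le]; ring
  set t : ℝ := l * ε / 16 with ht
  have htpos : 0 < t := by positivity
  have htε : t < ε / 2 := by
    rw [ht]; nlinarith
  -- upper bound from zero-freeness
  have hup : Real.log ‖G t‖ ≤ 8 * (N * ε) / ε ^ 2 * ‖(t : ℂ)‖ ^ 2 :=
    cfp_log_norm_le_of_zeroFree hε (by positivity) hGd hG0 hG1 hGbd hGder
      (by rw [Complex.norm_real, Real.norm_eq_abs, abs_of_pos htpos]; exact htε)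
  rw [Complex.norm_real, Real.norm_eq_abs, abs_of_pos htpos] at hup
  -- lower bound from long-range order
  have hlow : a₀ / 8 * Real.exp (t * (l * N)) ≤ ‖G t‖ := by
    have h4 := cfp_four_Zfield (L := L) J t
    have hlb := cfp_lower_bound (L := L) (J := J) ha₀.le hpl htpos.le
    rw [hG]
    simp only
    rw [norm_div, hnormZf0, le_div_iff₀ hZ0pos]
    set I : ℝ := ∫ θ in cube L, w θ *
        (Real.exp (t * ∑ x, Real.cos (θ x)) + Real.exp (-(t * ∑ x, Real.cos (θ x))) +
          Real.exp (t * ∑ x, Real.sin (θ x)) + Real.exp (-(t * ∑ x, Real.sin (θ x)))) with hI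
    have hZft4 : 4 * Zf t = ((I : ℝ) : ℂ) := h4
    have hZft : Zf t = ((I : ℝ) : ℂ) / 4 :=
      eq_div_of_mul_eq (by norm_num) (by rw [mul_comm]; exact hZft4)
    have hInn : 0 ≤ I :=
      le_trans (by positivity) hlb
    have h4n : ‖(4 : ℂ)‖ = 4 := by
      rw [show (4 : ℂ) = ((4 : ℝ) : ℂ) by norm_cast, Complex.norm_real, Real.norm_eq_abs]
      norm_num
    rw [hZft, norm_div, h4n, Complex.norm_real, Real.norm_eq_abs, abs_of_nonneg hInn, hl, hN]
    linarith
  -- combine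
  have hGtpos : 0 < ‖G t‖ := lt_of_lt_of_le (by positivity) hlow
  have hlog := (Real.log_le_log (by positivity) hlow).trans hup
  rw [Real.log_mul (by positivity) (Real.exp_pos _).ne', Real.log_exp] at hlog
  -- `hlog : log (a₀/8) + t (l N) ≤ 8 (N ε)/ε² t²`; with `t = l ε/16` this says `l² ε N / 32 ≤ log (8/a₀)`
  have hlog8 : Real.log (a₀ / 8) = -Real.log (8 / a₀) := by
    rw [← Real.log_inv, inv_div]
  rw [hlog8, ht] at hlog
  have hkey : l ^ 2 * ε * N / 32 ≤ Real.log (8 / a₀) := by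
    have hε0 : ε ≠ 0 := hε.ne'
    field_simp at hlog
    nlinarith [hlog, hε, hNpos, hlpos]
  -- i.e. `N ≤ 128 log(8/a₀)/(a₀ ε) = B`
  have hNB : N ≤ B := by
    rw [hB, le_div_iff₀ (by positivity), hl2] at *
    nlinarith [hkey, hε, ha₀]
  linarith

/-- **The charged-field variant is FALSE** — the same statement under its natural name (alias of the registered stub
`stub_chargedFieldPinching`); `¬ PerturbedXYOrderChargedField` of the strategist's census, verbatim up to unfolding `Zfield`. -/
theorem perturbedXYOrder_false_for_charged_field :
    ¬ (∃ J₀ ε : ℝ, 0 < ε ∧ ∀ J : ℝ, J₀ ≤ J → ∀ (L : ℕ) [NeZero L], 2 ≤ L →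
        ∀ η : ℂ, ‖η‖ ≤ ε →
          (∫ θ in cube L, wJ J θ * Complex.exp (η * ∑ x : TorusSite 3 L, (Real.cos (θ x) : ℂ))) ≠ 0) :=
  stub_chargedFieldPinching

end Summit.HubbardSuperconductivity.HubbardSuperconductivity.Theorems.PerturbedXYOrder

end
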